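import Summits.QuantumFields.BalabanUV.Gaps.EndDrawdownLinearFloorEntry
import Summits.QuantumFields.BalabanUV.Gaps.EndDrawdownLinearRoadStrict

/-!
# Gaps / EndDrawdownLinearRecovering — AT END GRADE THE LINEAR ROAD DOES NOT READ THE DRAWDOWN PROFILE: THE WITNESS.  By
# `EndDrawdownCooperatorExtremal` §5 possibility over the (AF-1) class is the END of the linear cooperator `b_k + C g_k` — ONE backward-orbit
# condition —, and `EndDrawdownLinearFloorEntry` gives the FLOOR–ENTRY sufficient condition for it.  THE RECOVERING STAIRCASE
# `bRec κ` = gen 9's dyadic staircase `bStair κ` (`−κ∕2^t` on position block `t`, `15·16^t` indices) with the LAST step of every block replaced by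
# a FULL RECOVERY `+(15·16^t − 1)κ∕2^t`: same rates, same geometry, drawdown profile of the same cubic order `κ⁴∕ε³` — so the quadratic sufficient
# condition of `EndDrawdownLinearRoad.endPossibleLin_of_quadraticProfile` FAILS for EVERY `C` (`not_quadraticProfile_bRec`) —, yet `bRec κ` is
# POSSIBLE on the linear road for EVERY `C > 0` and every box (`endPossibleLin_bRec`), while `bStair κ` is possible for NO `C`
# (`EndDrawdownLinearRoadStrict.not_endPossibleLin_bStair`).  It meets the FLOOR–ENTRY condition at every level (`floorEntry_bRec`): every window
# ending at a block START is `≥ 0` (`sum_bRec_to_blockStart_nonneg` — the recovery banks the block: ENTRY drawdown `0` at the checkpoints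
# `16^T − 1`), every window is `≥ −15κ·8^t` with `t` the block of its last index (`sum_bRec_ge`: internal drawdown `15κ·8^T` below the checkpoint),
# and the tail rate `κ∕2^T` beyond the checkpoint has floor `(C·2^T∕κ)² → ∞`.  So what the
# linear road reads of `β⁰` for POSSIBILITY at END grade is NOT the size of its drawdown profile (census rows R79 ∕ R80 sharpened: «quadratic
# profile» is sufficient only) but whether drawdown at each rate is RECOVERED before drawdown at smaller rates sets in (cell pub-balaban-gaps,
# seat g1-p3 GEN 10, rows CAP ∕ tail ∕ (D4) «split ∕ weakening»; this seat's own leaf; file 19 of «the one-loop interface of the END statement»)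

HONEST FRAMING (cell rule, page 1 of everything): [folklore] real analysis on the tree's clamped-run carrier + window arithmetic for ONE explicit
TOY one-loop sequence; `EndPossibleLin` is a quantified READING of the cell's END-grade statement over Bałaban-free data `(b, C, γ₀)`, not a
binder; the (AF-1) linear road is a located UNPRINTED hypothesis shape ([I] (2.12)–(2.14) ∕ [II] p. 8 after (1.29); `CapSignsConstRoad` §1);
NOTHING of Bałaban's table is certified (NODE-O 0∕1, CAP coefficients 0); words ∕ odds of rows CAP ∕ tail ∕ (D4) ∕ (D1) UNCHANGED; 0∕6 binders;
one finite T⁴; NOT [I] Thm 2, NOT `BetaPertH`, NOT the continuum limit, NOT Clay.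

CITATION HEADER (tags CONTEXT ONLY).  [I] = T. Bałaban, Commun. Math. Phys. **109** (1987) 249–301 [Balaban1987RG1]: (0.20) p. 256, Thm 2
p. 259 (first sentence), Thm 3 p. 264, (2.12)–(2.14) p. 268.
-/

namespace Summit.QuantumFields.BalabanUV.Gaps.EndDrawdownLinearRecovering

open Literature.MathematicalPhysics.QuantumFieldTheory.Balaban1983to89
open Literature.MathematicalPhysics.QuantumFieldTheory.Balaban1983to89.FlowStep
open Literature.MathematicalPhysics.QuantumFieldTheory.Balaban1983to89.FlowStepRuns
open Literature.MathematicalPhysics.QuantumFieldTheory.Balaban1983to89.DagBinding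
open Summit.QuantumFields.BalabanUV.Gaps.EndDrawdownSeq (DwSeq)
open Summit.QuantumFields.BalabanUV.Gaps.EndDrawdownEverySlope (EndPossibleES)
open Summit.QuantumFields.BalabanUV.Gaps.EndDrawdownLinearRoad
open Summit.QuantumFields.BalabanUV.Gaps.EndDrawdownLinearRoadStrict (blk bStair blk_of_mem lt_pow_of_blk_lt not_endPossibleLin_bStair
  endPossibleES_bStair)
open Summit.QuantumFields.BalabanUV.Gaps.EndDrawdownCooperatorExtremal
open Summit.QuantumFields.BalabanUV.Gaps.EndDrawdownLinearFloorEntry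
open Finset

noncomputable section

/-! ## §1 The recovering staircase `bRec κ`: the staircase with the last step of every block replaced by a full recovery -/

section Rec

variable {κ : ℝ}

/-- The first index of position block `t`: `16^t − 1` (block `t` = `{j : 16^t ≤ j+1 < 16^{t+1}}`, `EndDrawdownLinearRoadStrict.blk`). [folklore] -/
def blockStart (t : ℕ) : ℕ := 16 ^ t - 1

/-- `blockStart t + 1 = 16^t`. [folklore] -/
theorem blockStart_add_one (t : ℕ) : blockStart t + 1 = 16 ^ t :=
  Nat.sub_add_cancel (Nat.one_le_pow _ _ (by norm_num))

/-- `blockStart t ≤ j ⟺ t ≤ blk j`. [folklore] -/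
theorem blockStart_le_iff {t j : ℕ} : blockStart t ≤ j ↔ t ≤ blk j := by
  have h1 : blockStart t ≤ j ↔ 16 ^ t ≤ j + 1 := by
    have := blockStart_add_one t; constructor <;> intro h <;> omega
  rw [h1]
  exact (Nat.le_log_iff_pow_le (by norm_num) (Nat.succ_ne_zero j)).symm

/-- THE RECOVERING STAIRCASE · `bRec κ j := −κ∕2^{blk j}` except at the LAST index of each block (`j + 2 = 16^{blk j + 1}`), where
`bRec κ j := +(15·16^{blk j} − 1)·κ∕2^{blk j}` recovers the whole block. A TOY. [folklore] -/
def bRec (κ : ℝ) (j : ℕ) : ℝ :=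
  if j + 2 = 16 ^ (blk j + 1) then κ / 2 ^ blk j * (15 * 16 ^ blk j - 1) else -(κ / 2 ^ blk j)

/-- Off the recovery indices `bRec` IS the staircase. [folklore] -/
theorem bRec_eq_bStair {j : ℕ} (h : j + 2 ≠ 16 ^ (blk j + 1)) : bRec κ j = bStair κ j := by
  unfold bRec bStair; rw [if_neg h]

/-- At a recovery index. [folklore] -/
theorem bRec_of_recovery {j : ℕ} (h : j + 2 = 16 ^ (blk j + 1)) : bRec κ j = κ / 2 ^ blk j * (15 * 16 ^ blk j - 1) := by
  unfold bRec; rw [if_pos h]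

/-- Every term is at least minus the rate of its block (`0 ≤ κ`). [folklore] -/
theorem neg_rate_le_bRec (hκ : 0 ≤ κ) (j : ℕ) : -(κ / 2 ^ blk j) ≤ bRec κ j := by
  unfold bRec
  split_ifs with h
  · have h1 : (0 : ℝ) ≤ κ / 2 ^ blk j := by positivity
    have h2 : (0 : ℝ) ≤ 15 * 16 ^ blk j - 1 := by linarith [one_le_pow₀ (show (1 : ℝ) ≤ 16 by norm_num) (n := blk j)]
    nlinarith [mul_nonneg h1 h2]
  · exact le_rfl

/-- **EVERY WINDOW ENDING AT A BLOCK START IS NON-NEGATIVE** (`0 ≤ κ`): complete blocks sum to `0`, and a window starting inside a block and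
running to its end contains the recovery, which outweighs the at most `15·16^t − 1` rate steps before it. [folklore] -/
theorem sum_bRec_to_blockStart_nonneg (hκ : 0 ≤ κ) : ∀ t i : ℕ, 0 ≤ ∑ j ∈ Ico i (blockStart t), bRec κ j := by
  intro t
  induction t with
  | zero => intro i; simp [blockStart]
  | succ t ih =>
    intro i
    obtain ⟨hp, h16⟩ : 16 ^ (t + 1) = 16 * 16 ^ t ∧ 1 ≤ 16 ^ t := ⟨by rw [pow_succ, mul_comm], Nat.one_le_pow _ _ (by norm_num)⟩
    obtain ⟨hs, hs'⟩ : blockStart t + 1 = 16 ^ t ∧ blockStart (t + 1) + 1 = 16 ^ (t + 1) := ⟨blockStart_add_one _, blockStart_add_one _⟩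
    have htail : ∀ i₀, blockStart t ≤ i₀ → 0 ≤ ∑ j ∈ Ico i₀ (blockStart (t + 1)), bRec κ j := by
      intro i₀ hi₀
      by_cases hlt : i₀ < blockStart (t + 1)
      · set r : ℕ := blockStart (t + 1) - 1 with hr
        have hr1 : blockStart (t + 1) = r + 1 := by omega
        have hi₀r : i₀ ≤ r := by omega
        rw [hr1, Finset.sum_Ico_succ_top hi₀r]
        have hblk : ∀ j, i₀ ≤ j → j ≤ r → blk j = t := fun j hj1 hj2 => blk_of_mem (by omega) (by omega)
        have hrec : bRec κ r = κ / 2 ^ t * (15 * 16 ^ t - 1) := by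
          rw [bRec_of_recovery (by rw [hblk r hi₀r le_rfl]; omega), hblk r hi₀r le_rfl]
        have hrate : -(((r - i₀ : ℕ) : ℝ) * (κ / 2 ^ t)) ≤ ∑ j ∈ Ico i₀ r, bRec κ j := by
          have h1 : ∑ j ∈ Ico i₀ r, (-(κ / 2 ^ t)) ≤ ∑ j ∈ Ico i₀ r, bRec κ j :=
            Finset.sum_le_sum fun j hj => by
              have := neg_rate_le_bRec hκ j
              rwa [hblk j (Finset.mem_Ico.mp hj).1 (by have := (Finset.mem_Ico.mp hj).2; omega)] at this
          rwa [Finset.sum_const, Nat.card_Ico, nsmul_eq_mul, mul_neg] at h1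
        have hcard : ((r - i₀ : ℕ) : ℝ) ≤ 15 * 16 ^ t - 1 := by
          have h1 : r - i₀ + 1 ≤ 15 * 16 ^ t := by omega
          have h2 : ((r - i₀ + 1 : ℕ) : ℝ) ≤ ((15 * 16 ^ t : ℕ) : ℝ) := by exact_mod_cast h1
          push_cast at h2; linarith
        rw [hrec]
        have hε : (0 : ℝ) ≤ κ / 2 ^ t := by positivity
        nlinarith [mul_le_mul_of_nonneg_right hcard hε]
      · rw [Finset.Ico_eq_empty_of_le (not_lt.mp hlt), Finset.sum_empty]
    by_cases hi : blockStart t ≤ i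
    · exact htail i hi
    · rw [← Finset.sum_Ico_consecutive _ (not_le.mp hi).le (by omega : blockStart t ≤ blockStart (t + 1))]
      exact add_nonneg (ih i) (htail _ le_rfl)

/-- The drawdown window of block `t`: over its `15·16^t − 1` rate steps, `Σ (bRec + κ∕2^{t+1}) = −(15·16^t − 1)·κ∕2^{t+1}`. [folklore] -/
theorem window_bRec (κ : ℝ) (t : ℕ) :
    ∑ j ∈ Ico (blockStart t) (blockStart (t + 1) - 1), (bRec κ j + κ / 2 ^ (t + 1)) = -((15 * 16 ^ t - 1) * (κ / 2 ^ (t + 1))) := by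
  obtain ⟨hp, h16⟩ : 16 ^ (t + 1) = 16 * 16 ^ t ∧ 1 ≤ 16 ^ t := ⟨by rw [pow_succ, mul_comm], Nat.one_le_pow _ _ (by norm_num)⟩
  obtain ⟨hs, hs'⟩ : blockStart t + 1 = 16 ^ t ∧ blockStart (t + 1) + 1 = 16 ^ (t + 1) := ⟨blockStart_add_one _, blockStart_add_one _⟩
  set r : ℕ := blockStart (t + 1) - 1 with hr
  have hval : ∀ j ∈ Ico (blockStart t) r, bRec κ j + κ / 2 ^ (t + 1) = -(κ / 2 ^ (t + 1)) := by
    intro j hj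
    obtain ⟨hj1, hj2⟩ := Finset.mem_Ico.mp hj
    have hblk : blk j = t := blk_of_mem (by omega) (by omega)
    have hne : j + 2 ≠ 16 ^ (blk j + 1) := by rw [hblk]; omega
    rw [bRec_eq_bStair hne]
    unfold bStair
    rw [hblk, pow_succ]
    field_simp
    ring
  rw [Finset.sum_congr rfl hval, Finset.sum_const, Nat.card_Ico, nsmul_eq_mul]
  have hcard : ((r - blockStart t : ℕ) : ℝ) = 15 * 16 ^ t - 1 := by
    have h1 : r - blockStart t + 1 = 15 * 16 ^ t := by omega
    have h2 : ((r - blockStart t + 1 : ℕ) : ℝ) = ((15 * 16 ^ t : ℕ) : ℝ) := by exact_mod_cast h1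
    push_cast at h2; linarith
  rw [hcard]
  ring

end Rec

/-! ## §2 The recovering staircase is possible on EVERY linear road; its profile is not quadratic; the staircase contrast -/

section Headline

variable {κ C : ℝ}

/-- Every window of `bRec κ` (`κ ≥ 0`) is bounded below by the depth of the block of its last index: `Σ_{[i,K)} bRec ≥ −15κ·8^{blk(K−1)}`
(windows into the block start are `≥ 0`; inside the block each term is `≥ −κ∕2^t` and there are at most `15·16^t` of them). [folklore] -/
theorem sum_bRec_ge (hκ : 0 ≤ κ) {i K : ℕ} (hiK : i ≤ K) (hK : 1 ≤ K) :
    -(15 * κ * 8 ^ blk (K - 1)) ≤ ∑ j ∈ Ico i K, bRec κ j := by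
  set t : ℕ := blk (K - 1) with ht
  obtain ⟨hp, hs⟩ : 16 ^ (t + 1) = 16 * 16 ^ t ∧ blockStart t + 1 = 16 ^ t := ⟨by rw [pow_succ, mul_comm], blockStart_add_one t⟩
  have hKlt : K - 1 + 1 < 16 ^ (t + 1) := lt_pow_of_blk_lt (by rw [← ht]; exact Nat.lt_succ_self t)
  have hsK : blockStart t ≤ K := (blockStart_le_iff.mpr (le_of_eq ht)).trans (Nat.sub_le K 1)
  have hblk : ∀ j, blockStart t ≤ j → j < K → blk j = t := by
    intro j hj1 hj2
    have h1 : t ≤ blk j := blockStart_le_iff.mp hj1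
    have h2 : blk j ≤ t := by rw [ht]; exact Nat.log_mono_right (by omega)
    omega
  -- the part of the window inside block `t`
  have hin : ∀ i', blockStart t ≤ i' → i' ≤ K → -(15 * κ * 8 ^ t) ≤ ∑ j ∈ Ico i' K, bRec κ j := by
    intro i' hi1 hi2
    have hrate : -(((K - i' : ℕ) : ℝ) * (κ / 2 ^ t)) ≤ ∑ j ∈ Ico i' K, bRec κ j := by
      have h1 : ∑ j ∈ Ico i' K, (-(κ / 2 ^ t)) ≤ ∑ j ∈ Ico i' K, bRec κ j :=
        Finset.sum_le_sum fun j hj => by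
          have := neg_rate_le_bRec hκ j
          rwa [hblk j (hi1.trans (Finset.mem_Ico.mp hj).1) (Finset.mem_Ico.mp hj).2] at this
      rwa [Finset.sum_const, Nat.card_Ico, nsmul_eq_mul, mul_neg] at h1
    have hcard : ((K - i' : ℕ) : ℝ) ≤ 15 * 16 ^ t := by
      have h1 : K - i' ≤ 15 * 16 ^ t := by omega
      exact_mod_cast h1
    have h8 : (15 : ℝ) * 16 ^ t * (κ / 2 ^ t) = 15 * κ * 8 ^ t := by
      rw [show (16 : ℝ) ^ t = 2 ^ t * 8 ^ t by rw [← mul_pow]; norm_num]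
      field_simp
    have hε : (0 : ℝ) ≤ κ / 2 ^ t := by positivity
    nlinarith [mul_le_mul_of_nonneg_right hcard hε]
  by_cases hi : blockStart t ≤ i
  · exact hin i hi hiK
  · rw [← Finset.sum_Ico_consecutive _ (not_le.mp hi).le hsK]
    linarith [sum_bRec_to_blockStart_nonneg hκ t i, hin _ le_rfl hsK]

/-- **THE RECOVERING STAIRCASE MEETS THE FLOOR–ENTRY CONDITION FOR EVERY `C > 0`** (`κ > 0`): at level `A` take the block start `I = 16^T − 1`
with `(C·2^T∕κ)² ≥ A`, tail rate `ρ = κ∕2^T`, internal drawdown `15κ·8^T`, entry drawdown `0`. [folklore] -/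
theorem floorEntry_bRec (hκ : 0 < κ) (hC : 0 < C) {A : ℝ} (hA : 0 < A) :
    ∃ (I : ℕ) (ρ Dint Dent : ℝ), 0 < ρ ∧ (∀ j, I ≤ j → -ρ ≤ bRec κ j) ∧
      (∀ i K', i ≤ K' → K' ≤ I → -Dint ≤ ∑ j ∈ Ico i K', bRec κ j) ∧ (∀ i, i ≤ I → -Dent ≤ ∑ j ∈ Ico i I, bRec κ j) ∧
        A + Dent ≤ (C / ρ) ^ 2 := by
  obtain ⟨T, hT⟩ : ∃ T : ℕ, A ≤ (C * 2 ^ T / κ) ^ 2 := by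
    obtain ⟨T, hT⟩ := pow_unbounded_of_one_lt (Real.sqrt A * κ / C) (by norm_num : (1 : ℝ) < 2)
    refine ⟨T, ?_⟩
    have h1 : Real.sqrt A ≤ C * 2 ^ T / κ := by
      rw [le_div_iff₀ hκ]; rw [div_lt_iff₀ hC] at hT; linarith
    calc A = Real.sqrt A ^ 2 := (Real.sq_sqrt hA.le).symm
      _ ≤ (C * 2 ^ T / κ) ^ 2 := pow_le_pow_left₀ (Real.sqrt_nonneg _) h1 2
  refine ⟨blockStart T, κ / 2 ^ T, 15 * κ * 8 ^ T, 0, by positivity, fun j hj => ?_, fun i K' hiK hKI => ?_,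
    fun i _ => by linarith [sum_bRec_to_blockStart_nonneg hκ.le T i], ?_⟩
  · have hT' : T ≤ blk j := blockStart_le_iff.mp hj
    have h1 : κ / 2 ^ blk j ≤ κ / 2 ^ T := div_le_div_of_nonneg_left hκ.le (by positivity) (pow_le_pow_right₀ (by norm_num) hT')
    linarith [neg_rate_le_bRec hκ.le j]
  · rcases Nat.eq_zero_or_pos K' with hK0 | hK
    · subst hK0; simp; positivity
    · have h1 := sum_bRec_ge hκ.le hiK hK
      have ht : blk (K' - 1) < T := by
        by_contra hge
        have := blockStart_le_iff.mpr (not_lt.mp hge)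
        omega
      have h2 : (8 : ℝ) ^ blk (K' - 1) ≤ 8 ^ T := pow_le_pow_right₀ (by norm_num) ht.le
      nlinarith
  · rw [add_zero, show C / (κ / 2 ^ T) = C * 2 ^ T / κ by field_simp]
    exact hT

/-- **EVERY FORWARD-GENERATED CONSTRUCTION OF THE LINEAR COOPERATOR OF `bRec κ` HAS E**, for EVERY `C > 0` (`κ > 0`).
[cite: Balaban1987RG1, Thm 2 p.259 (first sentence) and (0.20) p.256] -/
theorem endpointExistence_recCoop (hκ : 0 < κ) (hC : 0 < C) {β : HBeta}
    (hβ : ∀ (k : ℕ) (p : Fin (k + 1) → ℝ), 0 < p (Fin.last k) → β k p = bRec κ k + C * p (Fin.last k))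
    {Cn : B12.Construction} (hgen : ForwardGenerated Cn β) : EndpointExistence Cn :=
  endpointExistence_linCoop_of_floorEntry hC (fun _ hA => floorEntry_bRec hκ hC hA) hβ hgen

/-- **THE RECOVERING STAIRCASE IS POSSIBLE ON THE LINEAR ROAD FOR EVERY `C > 0` AND EVERY BOX** (`κ > 0`).
[cite: Balaban1987RG1, Thm 2 p.259 (first sentence) and (2.12)–(2.14) p.268] -/
theorem endPossibleLin_bRec (hκ : 0 < κ) (hC : 0 < C) {γ₀ : ℝ} (hγ₀ : 0 < γ₀) : EndPossibleLin (bRec κ) C γ₀ :=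
  endPossibleLin_of_floorEntry hC hγ₀ fun _ hA => floorEntry_bRec hκ hC hA

/-- … hence (the every-slope necessity, read off possibility) it has bounded drawdown below every negative line … [folklore] -/
theorem dwSeq_neg_bRec (hκ : 0 < κ) {ε : ℝ} (hε : 0 < ε) : DwSeq (bRec κ) (-ε) :=
  dwSeq_neg_of_endPossibleLin zero_le_one one_pos (endPossibleLin_bRec hκ one_pos one_pos) hε

/-- … and is possible over the every-slope class on every box. [cite: Balaban1987RG1, Thm 2 p.259 (first sentence) and Thm 3 p.264] -/
theorem endPossibleES_bRec (hκ : 0 < κ) {γc : ℝ} (hγc : 0 < γc) : EndPossibleES (bRec κ) γc :=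
  endPossibleES_of_endPossibleLin zero_le_one hγc (endPossibleLin_bRec hκ one_pos hγc)

/-- **ITS DRAWDOWN PROFILE IS NOT QUADRATIC ON ANY LINEAR ROAD** · for EVERY `C > 0` and `γ₁ > 0` the hypothesis of
`EndDrawdownLinearRoad.endPossibleLin_of_quadraticProfile` FAILS for `bRec κ`: at `γ = κ∕(C·2^t)` (threshold `Cγ∕2 = κ∕2^{t+1}`) the rate steps of
block `t` draw down `(15·16^t − 1)κ∕2^{t+1} ≥ 7κ·8^t > 3∕γ² = 3C²4^t∕κ²` once `2^t > 3C²∕(7κ³)` — a CUBIC profile `≍ κ⁴∕ε³`, like the staircase's.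
[folklore] -/
theorem not_quadraticProfile_bRec (hκ : 0 < κ) (hC : 0 < C) {γ₁ : ℝ} (hγ₁ : 0 < γ₁) :
    ¬ ∀ γ : ℝ, 0 < γ → γ ≤ γ₁ → ∃ M : ℝ, M ≤ 3 / γ ^ 2 ∧
      ∀ k m : ℕ, k ≤ m → -M ≤ ∑ j ∈ Ico k m, (bRec κ j + C * γ / 2) := by
  intro h
  obtain ⟨t, ht⟩ := pow_unbounded_of_one_lt (max (κ / (C * γ₁)) (3 * C ^ 2 / (7 * κ ^ 3))) (by norm_num : (1 : ℝ) < 2)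
  have ht1 : κ / (C * γ₁) < 2 ^ t := (le_max_left _ _).trans_lt ht
  have ht2 : 3 * C ^ 2 / (7 * κ ^ 3) < 2 ^ t := (le_max_right _ _).trans_lt ht
  set γ : ℝ := κ / (C * 2 ^ t) with hγdef
  have hγ : 0 < γ := by positivity
  have hγle : γ ≤ γ₁ := by
    rw [hγdef, div_le_iff₀ (by positivity)]
    rw [div_lt_iff₀ (by positivity)] at ht1
    nlinarith
  obtain ⟨M, hM, hwin⟩ := h γ hγ hγle
  have hthr : C * γ / 2 = κ / 2 ^ (t + 1) := by rw [hγdef, pow_succ]; field_simp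
  have h16 : 1 ≤ 16 ^ t := Nat.one_le_pow _ _ (by norm_num)
  have hle : blockStart t ≤ blockStart (t + 1) - 1 := by
    have := blockStart_add_one t; have := blockStart_add_one (t + 1)
    have hp : 16 ^ (t + 1) = 16 * 16 ^ t := by rw [pow_succ, mul_comm]
    omega
  have hw := hwin (blockStart t) (blockStart (t + 1) - 1) hle
  rw [hthr, window_bRec κ t] at hw
  -- `M ≥ (15·16^t − 1) κ∕2^{t+1} ≥ 7κ 8^t > 3C² 4^t∕κ² = 3∕γ²`
  have hγsq : 3 / γ ^ 2 = 3 * C ^ 2 * 4 ^ t / κ ^ 2 := by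
    rw [hγdef, show (4 : ℝ) ^ t = (2 ^ t) ^ 2 by rw [← pow_mul, mul_comm, pow_mul]; norm_num]
    field_simp
  have h7 : 7 * κ * 8 ^ t ≤ (15 * 16 ^ t - 1) * (κ / 2 ^ (t + 1)) := by
    have h1 : (1 : ℝ) ≤ 16 ^ t := one_le_pow₀ (by norm_num)
    have e16 : (16 : ℝ) ^ t = 2 ^ t * 8 ^ t := by rw [← mul_pow]; norm_num
    rw [pow_succ, e16]
    have h2t : (0 : ℝ) < 2 ^ t := by positivity
    have h8t : (0 : ℝ) < 8 ^ t := by positivity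
    rw [e16] at h1
    field_simp
    nlinarith [mul_pos h2t h8t, mul_pos hκ h8t, h1]
  have hbig : 3 * C ^ 2 * 4 ^ t / κ ^ 2 < 7 * κ * 8 ^ t := by
    rw [div_lt_iff₀ (by positivity)]
    rw [div_lt_iff₀ (by positivity)] at ht2
    have e8 : (8 : ℝ) ^ t = 2 ^ t * 4 ^ t := by rw [← mul_pow]; norm_num
    rw [e8]
    have h4t : (0 : ℝ) < 4 ^ t := by positivity
    nlinarith [mul_pos (mul_pos hκ (pow_pos hκ 2)) h4t]
  linarith

/-- **THE CONTRAST** (`κ > 0`) · the recovering staircase is possible on EVERY linear road, the staircase on NONE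
(`EndDrawdownLinearRoadStrict.not_endPossibleLin_bStair`), and the two sequences agree off the recovery indices: ONE recovery step per block
turns «impossible for every C» into «possible for every C» at equal rates, equal geometry and drawdown profiles of the same cubic order.
[cite: Balaban1987RG1, Thm 2 p.259 (first sentence) and (2.12)–(2.14) p.268] -/
theorem recovering_possible_staircase_impossible (hκ : 0 < κ) :
    (∀ C γ₀ : ℝ, 0 < C → 0 < γ₀ → EndPossibleLin (bRec κ) C γ₀) ∧
      (∀ C γ₀ : ℝ, 0 < C → 0 < γ₀ → ¬ EndPossibleLin (bStair κ) C γ₀) ∧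
        ∀ j : ℕ, j + 2 ≠ 16 ^ (blk j + 1) → bRec κ j = bStair κ j :=
  ⟨fun _ _ hC hγ₀ => endPossibleLin_bRec hκ hC hγ₀, fun _ _ hC hγ₀ => not_endPossibleLin_bStair hκ hC hγ₀,
    fun _ hj => bRec_eq_bStair hj⟩

/-- **POSSIBILITY ON THE LINEAR ROAD IS PROFILE-BLIND** · there is a one-loop sequence possible on EVERY linear road (every `C > 0`, every box)
whose drawdown profile defeats the quadratic sufficient condition of `EndDrawdownLinearRoad.endPossibleLin_of_quadraticProfile` for EVERY `C`;
with `EndDrawdownLinearRoadStrict.dwSeq_neg_not_sufficient_linear` (a sequence with a profile of the same order possible on NO linear road):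
what the (AF-1) road reads of `β⁰` for possibility at END grade is not the size of its drawdown profile. [folklore] -/
theorem linear_possibility_profile_blind :
    ∃ b : ℕ → ℝ, (∀ C γ₀ : ℝ, 0 < C → 0 < γ₀ → EndPossibleLin b C γ₀) ∧
      ∀ C γ₁ : ℝ, 0 < C → 0 < γ₁ → ¬ ∀ γ : ℝ, 0 < γ → γ ≤ γ₁ → ∃ M : ℝ, M ≤ 3 / γ ^ 2 ∧
        ∀ k m : ℕ, k ≤ m → -M ≤ ∑ j ∈ Ico k m, (b j + C * γ / 2) :=
  ⟨bRec 1, fun _ _ hC hγ₀ => endPossibleLin_bRec one_pos hC hγ₀, fun _ _ hC hγ₁ => not_quadraticProfile_bRec one_pos hC hγ₁⟩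

end Headline

end

end Summit.QuantumFields.BalabanUV.Gaps.EndDrawdownLinearRecovering
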